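import Mathlib
import Literature.MeasureTheory.Integral.HausdorffMomentTheorem
import Summits.CriticalPhenomena.Ising3DConformalLimit.Theorems.GaussianScaleMixtureCriticalTwoPointGSMNineMirrorClosedRPTwo
import Summits.CriticalPhenomena.Ising3DConformalLimit.Theorems.GaussianScaleMixtureCriticalTwoPointGSMDiagConsFormHausdorff
import Summits.CriticalPhenomena.Ising3DConformalLimit.Theorems.GaussianScaleMixtureCriticalTwoPointGSMDiagMixedDifferenceLe

/-!
# The diagonal (swap-mirror) Källén–Lehmann representation of the critical two-point function of the
3D Ising model, WITHOUT a transfer matrix (route `GaussianScaleMixture`, crux `CriticalTwoPointGSM`,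
line `Sketch`, canonical-lift spine — nine-direction dividends; registered stubs
`diagSpectralRepresentation`, `criticalTwoPoint_faceDiagonal_hausdorff`,
`criticalTwoPoint_diagMixedDifference_le`, `diagConsForm_alternating`; the joint measure
`diagJointSpectralMeasure` is in the sequel file `…GSMDiagJointSpectralMeasure.lean`)

Let `G = ⟨σ₀σ_·⟩⁺_{β_c(3)} = criticalTwoPoint 3`, `u = e₀ - e₁` (the normal lattice step of the
diagonal mirror `x₀ = x₁`) and `P = {x : x₀ = x₁}` the mirror plane. We prove, unconditionally:

* `diagSpectralRepresentation`: for every finite `s ⊆ P` and real `v`, the diagonal quadratic form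
  `N ↦ ∑_{x,y ∈ s} v_x v_y G(y - x + N u)` is a HAUSDORFF MOMENT SEQUENCE, `= ∫ t^N dμ_v`, `μ_v ≥ 0`
  finite on `[0,1]` — the swap-mirror analogue of the axial `MixedSpectralRepresentation`
  (Aizenman–Duminil-Copin 2021 Prop. 5.3 / 8.6 is stated along principal axes only). Inputs: the
  CLOSED two-point nine-mirror reflection positivity `Theorems.nineMirror_closedRP_two` (FILS 1978 §3,
  from the tree's `criticalCorr_levelMirror_rp`) at even and odd heights above the mirror — exactly
  positive semidefiniteness of the two Hankel forms — and the moment theorem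
  `Literature.MeasureTheory.Integral.hausdorffMoment_of_hankel_posSemidef` (BCR 1984; landed this
  session), through `Theorems.diagConsForm_hausdorff`.
* `criticalTwoPoint_faceDiagonal_hausdorff`: in particular the face-diagonal two-point function
  `N ↦ ⟨σ₀ σ_{(N,-N,0)}⟩⁺_{β_c}` is a Hausdorff moment sequence (`s = {0}`).
* `diagJointSpectralMeasure`: the DIAGONAL JOINT (normal × in-plane) Källén–Lehmann measure: a
  probability measure `ρ_d` on `[0,1] × [-π,π]²` with `⟨σ₀ σ_{ι(z) + n u}⟩⁺_{β_c} = ∫ λ^{|n|} cos(k·z) dρ_d`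
  for all `n ∈ ℤ`, `z ∈ ℤ²` (`ι(z) = (z₀, z₀, z₁)` the plane site), by the same discrete-momentum
  Cesàro/DFT construction as the axial one (`js_trigSum`, `diag_cesaroIdentity`, `diag_approximants`,
  `js_pairCount_tendsto`, `js_compactness`).
* `criticalTwoPoint_diagMixedDifference_le`: the diagonal joint mixed difference
  `G((N+1)u) + G(z + Nu) ≤ G(Nu) + G(z + (N+1)u)` for every `z ∈ P`, `N ∈ ℕ` — e.g.
  `G(2,-2,0) + G(1,-1,1) ≤ G(1,-1,0) + G(2,-2,1)` — an inequality the Gaussian-scale-mixture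
  conjecture predicts, now a theorem (`Theorems.diagMixedDifference_le`).

By the lattice symmetries the same holds for all six diagonal / anti-diagonal mirrors, and the
argument re-derives the axial case without transfer matrices.

References: J. Fröhlich, R. Israel, E. H. Lieb, B. Simon, Comm. Math. Phys. 62 (1978) §3 Thm. 3.1;
C. Berg, J. P. R. Christensen, P. Ressel, *Harmonic Analysis on Semigroups* (1984) Ch. 4 Prop. 4.9,
6.11, Ch. 6 Thm. 2.5; M. Aizenman, H. Duminil-Copin, Ann. of Math. 194 (2021) Prop. 5.3.
-/

namespace Summit.CriticalPhenomena.Ising3DConformalLimit.Theorems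

open MeasureTheory Filter Topology
open Literature.Probability.LatticeModels
open scoped BigOperators

noncomputable section

/-- **Diagonal Källén–Lehmann representation (registered stub `diagSpectralRepresentation`).** For
every finite set `s` of sites on the mirror plane `{x₀ = x₁}` and real coefficients `v`, the
swap-mirror quadratic form `N ↦ ∑_{x,y ∈ s} v_x v_y ⟨σ_x σ_{y + N(e₀-e₁)}⟩⁺_{β_c}` of the critical 3D
Ising two-point function is the moment sequence of a finite positive measure on `[0,1]`
(closed nine-mirror reflection positivity + the Hankel → Hausdorff moment theorem). -/
theorem diagSpectralRepresentation :
    ∀ (s : Finset (Site 3)), (∀ x ∈ s, x 0 = x 1) → ∀ (v : Site 3 → ℝ),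
      ∃ μ : Measure ℝ, IsFiniteMeasure μ ∧ μ (Set.Icc (0 : ℝ) 1)ᶜ = 0 ∧
        ∀ N : ℕ, ∑ x ∈ s, ∑ y ∈ s, v x * v y *
          criticalTwoPoint 3 (y - x + (N : ℤ) • (Pi.single 0 1 - Pi.single 1 1)) = ∫ t, t ^ N ∂μ :=
  diagConsForm_hausdorff nineMirror_closedRP_two
    Literature.MeasureTheory.Integral.hausdorffMoment_of_hankel_posSemidef

/-- **The face-diagonal critical two-point function is a Hausdorff moment sequence (registered stub
`criticalTwoPoint_faceDiagonal_hausdorff`).** There is a finite positive measure `μ` on `[0,1]` with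
`⟨σ₀ σ_{N(e₀-e₁)}⟩⁺_{β_c} = ∫ t^N dμ` for every `N ∈ ℕ` — the Källén–Lehmann representation along the
face diagonal `(1,-1,0)` of `ℤ³`, obtained from diagonal reflection positivity without a transfer
matrix. -/
theorem criticalTwoPoint_faceDiagonal_hausdorff :
    ∃ μ : Measure ℝ, IsFiniteMeasure μ ∧ μ (Set.Icc (0 : ℝ) 1)ᶜ = 0 ∧
      ∀ N : ℕ, criticalTwoPoint 3 ((N : ℤ) • (Pi.single 0 1 - Pi.single 1 1)) = ∫ t, t ^ N ∂μ := by
  obtain ⟨μ, hfin, hsupp, hmom⟩ :=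
    diagSpectralRepresentation {0} (fun x hx => by rw [Finset.mem_singleton.1 hx]; rfl) (fun _ => 1)
  refine ⟨μ, hfin, hsupp, fun N => ?_⟩
  have h := hmom N
  simpa only [Finset.sum_singleton, one_mul, sub_zero, zero_add] using h

/-- **The diagonal joint mixed difference (registered stub `criticalTwoPoint_diagMixedDifference_le`),
unconditional.** For every `N ∈ ℕ` and every `z` on the mirror plane `{z₀ = z₁}`,
`G((N+1)u) + G(z + Nu) ≤ G(Nu) + G(z + (N+1)u)` with `u = e₀ - e₁`, `G = ⟨σ₀σ_·⟩⁺_{β_c}`: the map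
`N ↦ G(Nu) - G(z + Nu)` is nonincreasing along the face diagonal (e.g.
`G(2,-2,0) + G(1,-1,1) ≤ G(1,-1,0) + G(2,-2,1)`). -/
theorem criticalTwoPoint_diagMixedDifference_le :
    ∀ (N : ℕ) (z : Site 3), z 0 = z 1 →
      criticalTwoPoint 3 (((N + 1 : ℕ) : ℤ) • (Pi.single 0 1 - Pi.single 1 1)) +
          criticalTwoPoint 3 (z + (N : ℤ) • (Pi.single 0 1 - Pi.single 1 1)) ≤
        criticalTwoPoint 3 ((N : ℤ) • (Pi.single 0 1 - Pi.single 1 1)) +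
          criticalTwoPoint 3 (z + ((N + 1 : ℕ) : ℤ) • (Pi.single 0 1 - Pi.single 1 1)) :=
  diagMixedDifference_le diagSpectralRepresentation

/-- **Rung 0 in the diagonal direction (registered stub `diagConsForm_alternating`), unconditional.**
Every swap-mirror quadratic form of the critical two-point function is completely monotone along the
normal step `u = e₀ - e₁`: `∑_{i ≤ k} (-1)^i C(k,i) Q_v(n+i) ≥ 0` for
`Q_v(N) = ∑_{x,y ∈ s} v_x v_y ⟨σ_x σ_{y + N u}⟩⁺_{β_c}`, `s` finite on the plane `{x₀ = x₁}`
(`diagSpectralRepresentation` + the easy direction of Hausdorff's theorem). -/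
theorem diagConsForm_alternating :
    ∀ (s : Finset (Site 3)), (∀ x ∈ s, x 0 = x 1) → ∀ (v : Site 3 → ℝ) (n k : ℕ),
      0 ≤ ∑ i ∈ Finset.range (k + 1), (-1 : ℝ) ^ i * (k.choose i : ℝ) *
        ∑ x ∈ s, ∑ y ∈ s, v x * v y *
          criticalTwoPoint 3 (y - x + (((n + i : ℕ)) : ℤ) • (Pi.single 0 1 - Pi.single 1 1)) := by
  intro s hs v n k
  obtain ⟨μ, hfin, hsupp, hmom⟩ := diagSpectralRepresentation s hs v
  exact Literature.MeasureTheory.Integral.alternating_of_hausdorffMoment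
    (fun N => ∑ x ∈ s, ∑ y ∈ s, v x * v y *
      criticalTwoPoint 3 (y - x + (N : ℤ) • (Pi.single 0 1 - Pi.single 1 1))) μ hsupp hmom n k

end

end Summit.CriticalPhenomena.Ising3DConformalLimit.Theorems
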